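import Literature.Analysis.PDE.LinApriori
import HarnessLib

/-!
# Weighted maximal-regularity estimate for represented linear parabolic systems
# (topic `Analysis/PDE`)

Layer (III), step 3, of the programme to prove short-time existence for quasilinear strictly
parabolic systems on a closed manifold (hypothesis `hQL` of
`Literature.Geometry.Riemannian.ricciFlow_shortTime_existence_of_quasilinear`). The frozen
Picard scheme of that layer is a contraction in the weighted maximal-regularity norm

  `‖v‖²_{X,λ} = Σ_p ∫₀ᵗ e^{-2λs} [Σᵢⱼ E_k(∂ⱼ∂ᵢ w_p) + λ Σᵢ E_k(∂ᵢ w_p) + λ² E_k(w_p)] ds`,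
  `w_p = cutExpr P p (v s)`,

and this file packages the linear theory in that currency (`maxreg_apriori_le`): for a solution
of the represented linear system `∂ₜ v̂_p = frameOp (S p) (𝔟 p) (𝔠 p) v̂_p + ĝ_p` with
`v(0) = 0`, the `X`-quantity at time `t` and the pointwise weighted energies
`e^{-2λt} E_k(w_p(t))` are bounded by `C Σ_p ∫₀ᵗ e^{-2λs} E_k(cutExpr P p (g s))`, uniformly in
`λ ≥ Λ` — from the a priori estimate of the residuals (`linear_apriori_residual_le`) and the slab
estimates (`SlabSolutionEstimates.lean`: `λ⁻²` at the level, `λ⁻¹` for one derivative, maximal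
regularity for two).

Everything is proved; no named fact and no `sorry` is introduced.

## References

* L. C. Evans, *Partial Differential Equations*, 2nd ed., AMS 2010, §7.1.3 (improved
  regularity). [Evans2010]
-/

noncomputable section

open Set Function Filter Topology Metric MeasureTheory InnerProductSpace
open scoped Manifold ContDiff Topology ENNReal

namespace Literature.Analysis.PDE

open Literature.Geometry.Manifold Literature.Analysis.FunctionSpaces Literature.Analysis.FluidPDE

namespace PatchSystemLoc

variable {E : Type*} [NormedAddCommGroup E] [NormedSpace ℝ E] {H : Type*} [TopologicalSpace H]
variable {I : ModelWithCorners ℝ E H} {M : Type*} [TopologicalSpace M] [ChartedSpace H M]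
  [IsManifold I ∞ M] [I.Boundaryless] [T2Space M]
variable {E' : Type*} [NormedAddCommGroup E'] [InnerProductSpace ℝ E'] [FiniteDimensional ℝ E']
  [MeasurableSpace E'] [BorelSpace E']
variable {F' : Type*} [NormedAddCommGroup F'] [InnerProductSpace ℝ F'] [FiniteDimensional ℝ F']
variable {ι : Type*} [Fintype ι] {P : PatchSystem I M E' ι} {T : ℝ}

/-- **The weighted maximal-regularity quantity** of a slab family `w` at order `k`, weight `λ`,
up to time `t`: `∫₀ᵗ e^{-2λs} [Σᵢⱼ E_k(∂ⱼ∂ᵢ w) + λ Σᵢ E_k(∂ᵢ w) + λ² E_k(w)] ds`.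
[cite: Evans2010, §7.1.3] -/
def maxRegQ (k : ℕ) (lam : ℝ) (w : ℝ → E' → F') (t : ℝ) : ℝ≥0∞ :=
  ∫⁻ s in Ioo 0 t, ENNReal.ofReal (Real.exp (-2 * lam * s)) *
    ((∑ i, ∑ j, sobolevEnergy k (fun x ↦ fderiv ℝ (fun y ↦ fderiv ℝ (w s) y (stdOrthonormalBasis ℝ E' i)) x (stdOrthonormalBasis ℝ E' j))) +
      ENNReal.ofReal lam * ∑ i, sobolevEnergy k (fun x ↦ fderiv ℝ (w s) x (stdOrthonormalBasis ℝ E' i)) +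
      ENNReal.ofReal (lam ^ 2) * sobolevEnergy k (w s))

omit [MeasurableSpace E'] [BorelSpace E'] [FiniteDimensional ℝ F'] in
/-- `maxRegQ_eq`: unfolding. [folklore] -/
theorem maxRegQ_eq [MeasurableSpace E'] [BorelSpace E'] (k : ℕ) (lam : ℝ) (w : ℝ → E' → F') (t : ℝ) :
    maxRegQ k lam w t = ∫⁻ s in Ioo 0 t, ENNReal.ofReal (Real.exp (-2 * lam * s)) *
    ((∑ i, ∑ j, sobolevEnergy k (fun x ↦ fderiv ℝ (fun y ↦ fderiv ℝ (w s) y (stdOrthonormalBasis ℝ E' i)) x (stdOrthonormalBasis ℝ E' j))) +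
      ENNReal.ofReal lam * ∑ i, sobolevEnergy k (fun x ↦ fderiv ℝ (w s) x (stdOrthonormalBasis ℝ E' i)) +
      ENNReal.ofReal (lam ^ 2) * sobolevEnergy k (w s)) := rfl

/-- **The weighted maximal-regularity quantity of a slab family by its heat residual**:
`maxRegQ k λ w t ≤ (n + 2) ∫₀ᵗ e^{-2λs} E_k(∂ₜw - Δw)` for `λ ≥ 1`, `w` slab-smooth, compactly
supported, `w(0) = 0`. [cite: Evans2010, §7.1.3] -/
theorem maxRegQ_le_residual (hT : 0 < T) {w : ℝ → E' → F'} (hw : IsSmoothSpaceTimeOn (Icc 0 T) w) {K : Set E'}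
    (hK : IsCompact K) (hwK : ∀ s, ∀ y ∉ K, w s y = 0) (hw0 : ∀ y, w 0 y = 0) {lam : ℝ} (hlam : 1 ≤ lam) (k : ℕ)
    {t : ℝ} (ht : t ∈ Icc 0 T) :
    maxRegQ k lam w t ≤ ((Module.finrank ℝ E' : ℝ≥0∞) + 2) *
      ∫⁻ s in Ioo 0 t, ENNReal.ofReal (Real.exp (-2 * lam * s)) * sobolevEnergy k (slabResidual 1 T w s) := by
  have hlam0 : 0 < lam := by linarith
  set R := ∫⁻ s in Ioo 0 t, ENNReal.ofReal (Real.exp (-2 * lam * s)) * sobolevEnergy k (slabResidual 1 T w s) with hR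
  have h2 := lintegral_weight_sum_sobolevEnergy_fderiv_fderiv_le_residual (ν := (1 : ℝ)) hT one_pos hw hK hwK hw0 hlam0.le k ht
  have h1 := lintegral_weight_sum_sobolevEnergy_fderiv_le_residual (ν := (1 : ℝ)) hT one_pos hw hK hwK hw0 hlam0 k ht
  have h0 := lintegral_weight_sobolevEnergy_le_residual (ν := (1 : ℝ)) hT one_pos hw hK hwK hw0 hlam0 k ht
  -- measurability of the pieces
  have ht' : t ≤ T := ht.2
  have hd1 : ∀ i, IsSmoothSpaceTimeOn (Icc 0 T) fun s y ↦ fderiv ℝ (w s) y (stdOrthonormalBasis ℝ E' i) :=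
    fun i ↦ isSmoothSpaceTimeOn_fderiv_apply_Icc hT hw _
  have hd2 : ∀ i j, IsSmoothSpaceTimeOn (Icc 0 T) fun s x ↦
      fderiv ℝ (fun y ↦ fderiv ℝ (w s) y (stdOrthonormalBasis ℝ E' i)) x (stdOrthonormalBasis ℝ E' j) :=
    fun i j ↦ isSmoothSpaceTimeOn_fderiv_apply_Icc hT (hd1 i) _
  have hWm : Measurable fun s : ℝ ↦ ENNReal.ofReal (Real.exp (-2 * lam * s)) :=
    ENNReal.measurable_ofReal.comp (Real.measurable_exp.comp (measurable_const.mul measurable_id))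
  have mX : AEMeasurable (fun s ↦ ENNReal.ofReal (Real.exp (-2 * lam * s)) *
      ∑ i, ∑ j, sobolevEnergy k (fun x ↦ fderiv ℝ (fun y ↦ fderiv ℝ (w s) y (stdOrthonormalBasis ℝ E' i)) x (stdOrthonormalBasis ℝ E' j)))
      (volume.restrict (Ioo 0 t)) :=
    hWm.aemeasurable.mul (Finset.aemeasurable_fun_sum _ fun i _ ↦ Finset.aemeasurable_fun_sum _ fun j _ ↦
      aemeasurable_sobolevEnergy_slice isOpen_Ioo k ((hd2 i j).mono fun _ hs ↦ ⟨hs.1.le, hs.2.le.trans ht'⟩))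
  have mY : AEMeasurable (fun s ↦ ENNReal.ofReal lam * (ENNReal.ofReal (Real.exp (-2 * lam * s)) *
      ∑ i, sobolevEnergy k (fun x ↦ fderiv ℝ (w s) x (stdOrthonormalBasis ℝ E' i)))) (volume.restrict (Ioo 0 t)) :=
    (hWm.aemeasurable.mul (Finset.aemeasurable_fun_sum _ fun i _ ↦
      aemeasurable_sobolevEnergy_slice isOpen_Ioo k ((hd1 i).mono fun _ hs ↦ ⟨hs.1.le, hs.2.le.trans ht'⟩))).const_mul _
  have hfun : (fun s ↦ ENNReal.ofReal (Real.exp (-2 * lam * s)) *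
      ((∑ i, ∑ j, sobolevEnergy k (fun x ↦ fderiv ℝ (fun y ↦ fderiv ℝ (w s) y (stdOrthonormalBasis ℝ E' i)) x (stdOrthonormalBasis ℝ E' j))) +
        ENNReal.ofReal lam * ∑ i, sobolevEnergy k (fun x ↦ fderiv ℝ (w s) x (stdOrthonormalBasis ℝ E' i)) +
        ENNReal.ofReal (lam ^ 2) * sobolevEnergy k (w s))) =
      fun s ↦ (ENNReal.ofReal (Real.exp (-2 * lam * s)) *
        ∑ i, ∑ j, sobolevEnergy k (fun x ↦ fderiv ℝ (fun y ↦ fderiv ℝ (w s) y (stdOrthonormalBasis ℝ E' i)) x (stdOrthonormalBasis ℝ E' j)) +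
      ENNReal.ofReal lam * (ENNReal.ofReal (Real.exp (-2 * lam * s)) *
        ∑ i, sobolevEnergy k (fun x ↦ fderiv ℝ (w s) x (stdOrthonormalBasis ℝ E' i)))) +
      ENNReal.ofReal (lam ^ 2) * (ENNReal.ofReal (Real.exp (-2 * lam * s)) * sobolevEnergy k (w s)) := by
    funext s; ring
  have mXY : AEMeasurable (fun s ↦ ENNReal.ofReal (Real.exp (-2 * lam * s)) *
        ∑ i, ∑ j, sobolevEnergy k (fun x ↦ fderiv ℝ (fun y ↦ fderiv ℝ (w s) y (stdOrthonormalBasis ℝ E' i)) x (stdOrthonormalBasis ℝ E' j)) +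
      ENNReal.ofReal lam * (ENNReal.ofReal (Real.exp (-2 * lam * s)) *
        ∑ i, sobolevEnergy k (fun x ↦ fderiv ℝ (w s) x (stdOrthonormalBasis ℝ E' i)))) (volume.restrict (Ioo 0 t)) := mX.add mY
  have hsplit : maxRegQ k lam w t =
      (∫⁻ s in Ioo 0 t, ENNReal.ofReal (Real.exp (-2 * lam * s)) *
        ∑ i, ∑ j, sobolevEnergy k (fun x ↦ fderiv ℝ (fun y ↦ fderiv ℝ (w s) y (stdOrthonormalBasis ℝ E' i)) x (stdOrthonormalBasis ℝ E' j))) +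
      ENNReal.ofReal lam * (∫⁻ s in Ioo 0 t, ENNReal.ofReal (Real.exp (-2 * lam * s)) *
        ∑ i, sobolevEnergy k (fun x ↦ fderiv ℝ (w s) x (stdOrthonormalBasis ℝ E' i))) +
      ENNReal.ofReal (lam ^ 2) * (∫⁻ s in Ioo 0 t, ENNReal.ofReal (Real.exp (-2 * lam * s)) * sobolevEnergy k (w s)) := by
    rw [maxRegQ_eq, hfun, lintegral_add_left' mXY, lintegral_add_left' mX, lintegral_const_mul' _ _ ENNReal.ofReal_ne_top,
      lintegral_const_mul' _ _ ENNReal.ofReal_ne_top]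
  rw [hsplit]
  have hn : (Module.finrank ℝ E' : ℝ≥0∞) = ENNReal.ofReal ((Module.finrank ℝ E' : ℝ) / 1 ^ 2) := by
    rw [one_pow, div_one, ENNReal.ofReal_natCast]
  calc _ ≤ ENNReal.ofReal ((Module.finrank ℝ E' : ℝ) / 1 ^ 2) * R + ENNReal.ofReal lam * (ENNReal.ofReal (lam⁻¹ / (2 * 1)) * R) +
        ENNReal.ofReal (lam ^ 2) * (ENNReal.ofReal (lam⁻¹ ^ 2) * R) :=
        add_le_add (add_le_add h2 (mul_le_mul' le_rfl h1)) (mul_le_mul' le_rfl h0)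
    _ = ((Module.finrank ℝ E' : ℝ≥0∞) + ENNReal.ofReal (lam * (lam⁻¹ / 2)) + ENNReal.ofReal (lam ^ 2 * lam⁻¹ ^ 2)) * R := by
        rw [hn, ← mul_assoc, ← mul_assoc, ← ENNReal.ofReal_mul (by positivity), ← ENNReal.ofReal_mul (by positivity), mul_one]
        ring
    _ ≤ ((Module.finrank ℝ E' : ℝ≥0∞) + 2) * R := by
        refine mul_le_mul' ?_ le_rfl
        rw [add_assoc]
        refine add_le_add le_rfl ?_
        have h1' : ENNReal.ofReal (lam * (lam⁻¹ / 2)) ≤ 1 := by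
          rw [← ENNReal.ofReal_one]; refine ENNReal.ofReal_le_ofReal ?_
          rw [mul_div_assoc', mul_inv_cancel₀ hlam0.ne']; norm_num
        have h2' : ENNReal.ofReal (lam ^ 2 * lam⁻¹ ^ 2) ≤ 1 := by
          rw [← ENNReal.ofReal_one]; refine ENNReal.ofReal_le_ofReal (le_of_eq ?_)
          rw [inv_pow, mul_inv_cancel₀ (pow_ne_zero 2 hlam0.ne')]
        calc _ ≤ (1 : ℝ≥0∞) + 1 := add_le_add h1' h2'
          _ = 2 := one_add_one_eq_two

/-- **Weighted maximal-regularity a priori estimate for represented linear systems.** For every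
order `i` there are `Λ ≥ 1` and `C < ∞` such that for every `λ ≥ Λ`, every solution `v`
(`v(0) = 0`) of the chart form of the linear system with source `g`, and every `t ∈ [0, T]`:
`Σ_p maxRegQ i λ w_p t ≤ C Σ_p ∫₀ᵗ e^{-2λs} E_i(cutExpr P p (g s))` and, for every `p`,
`e^{-2λt} E_i(w_p(t)) ≤ C λ⁻¹ Σ_p ∫₀ᵗ e^{-2λs} E_i(cutExpr P p (g s))`.
[cite: Evans2010, §7.1.3] -/
theorem maxreg_apriori_le (hT : 0 < T) (i : ℕ) {S : ι → ℝ → E' → (E' →L[ℝ] E')}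
    {𝔟 : ι → ℝ → E' → ((E' →L[ℝ] F') →L[ℝ] F')} {𝔠 : ι → ℝ → E' → (F' →L[ℝ] F')}
    (hS : ∀ p, ContDiffOn ℝ ∞ (uncurry (S p)) (Icc 0 T ×ˢ (P.chart p).target))
    (h𝔟 : ∀ p, ContDiffOn ℝ ∞ (uncurry (𝔟 p)) (Icc 0 T ×ˢ (P.chart p).target))
    (h𝔠 : ∀ p, ContDiffOn ℝ ∞ (uncurry (𝔠 p)) (Icc 0 T ×ˢ (P.chart p).target)) {η : ℝ} (hη : 0 ≤ η)
    (hηS : ∀ p, ∀ s ∈ Icc 0 T, ∀ y ∈ closedBall (0 : E') (4 * P.r p), ‖S p s y - 1‖ ≤ η)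
    (hsmall : 16 * (Module.finrank ℝ E' : ℝ) ^ 3 * η ^ 2 ≤ 1) :
    ∃ Λ : ℝ, 1 ≤ Λ ∧ ∃ C : ℝ≥0∞, C ≠ ⊤ ∧ ∀ {lam : ℝ}, Λ ≤ lam → ∀ {v g : ℝ → M → F'},
      (∀ p, ContDiffOn ℝ ∞ (uncurry fun s y ↦ v s ((P.chart p).inv y)) (Icc 0 T ×ˢ (P.chart p).target)) →
      (∀ x, v 0 x = 0) →
      (∀ p, ContDiffOn ℝ ∞ (uncurry fun s y ↦ g s ((P.chart p).inv y)) (Icc 0 T ×ˢ (P.chart p).target)) →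
      (∀ p, ∀ s ∈ Icc 0 T, ∀ y ∈ (P.chart p).target,
        timeDerivWithin (Icc 0 T) (fun s y ↦ v s ((P.chart p).inv y)) s y =
          frameOp (S p s y) (𝔟 p s y) (𝔠 p s y) (fun y ↦ v s ((P.chart p).inv y)) y + g s ((P.chart p).inv y)) →
      ∀ t ∈ Icc 0 T,
        (∑ p, maxRegQ i lam (fun s ↦ cutExpr P p (v s)) t ≤
          C * ∑ p, ∫⁻ s in Ioo 0 t, ENNReal.ofReal (Real.exp (-2 * lam * s)) * sobolevEnergy i (cutExpr P p (g s))) ∧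
        ∀ p, ENNReal.ofReal (Real.exp (-2 * lam * t)) * sobolevEnergy i (cutExpr P p (v t)) ≤
          C * ENNReal.ofReal lam⁻¹ * ∑ p, ∫⁻ s in Ioo 0 t, ENNReal.ofReal (Real.exp (-2 * lam * s)) * sobolevEnergy i (cutExpr P p (g s)) := by
  classical
  obtain ⟨Λ, hΛ, C, hCtop, hC⟩ := linear_apriori_residual_le P hT i hS h𝔟 h𝔠 hη hηS hsmall
  refine ⟨max Λ 1, le_max_right _ _, ((Module.finrank ℝ E' : ℝ≥0∞) + 2) * C, ENNReal.mul_ne_top (by simp) hCtop, ?_⟩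
  intro lam hlam v g hv hv0 hg hchart t ht
  have hlamΛ : Λ ≤ lam := (le_max_left _ _).trans hlam
  have hlam1 : 1 ≤ lam := (le_max_right _ _).trans hlam
  have hlam0 : 0 < lam := by linarith
  have hap := hC hlamΛ hv hv0 hg hchart t ht
  set G := ∑ p, ∫⁻ s in Ioo 0 t, ENNReal.ofReal (Real.exp (-2 * lam * s)) * sobolevEnergy i (cutExpr P p (g s)) with hG
  have hw : ∀ p, IsSmoothSpaceTimeOn (Icc 0 T) fun s ↦ cutExpr P p (v s) := fun p ↦ isSmoothSpaceTimeOn_cutExpr P p (hv p)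
  refine ⟨?_, fun p ↦ ?_⟩
  · calc ∑ p, maxRegQ i lam (fun s ↦ cutExpr P p (v s)) t
        ≤ ∑ p, ((Module.finrank ℝ E' : ℝ≥0∞) + 2) *
            ∫⁻ s in Ioo 0 t, ENNReal.ofReal (Real.exp (-2 * lam * s)) * sobolevEnergy i (slabResidual 1 T (fun s ↦ cutExpr P p (v s)) s) :=
          Finset.sum_le_sum fun p _ ↦ maxRegQ_le_residual hT (hw p) (isCompact_closedBall (0 : E') (3 * P.r p))
            (fun s y hy ↦ cutExpr_family_eq_zero P p s hy) (cutExpr_family_zero P p hv0) hlam1 i ht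
      _ = ((Module.finrank ℝ E' : ℝ≥0∞) + 2) *
            ∑ p, ∫⁻ s in Ioo 0 t, ENNReal.ofReal (Real.exp (-2 * lam * s)) * sobolevEnergy i (slabResidual 1 T (fun s ↦ cutExpr P p (v s)) s) := by
          rw [Finset.mul_sum]
      _ ≤ ((Module.finrank ℝ E' : ℝ≥0∞) + 2) * (C * G) := mul_le_mul' le_rfl hap
      _ = _ := by rw [mul_assoc]
  · have hpt := weight_mul_sobolevEnergy_le_residual (ν := (1 : ℝ)) hT one_pos (hw p) (isCompact_closedBall (0 : E') (3 * P.r p))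
      (fun s y hy ↦ cutExpr_family_eq_zero P p s hy) (cutExpr_family_zero P p hv0) hlam0 i ht
    calc ENNReal.ofReal (Real.exp (-2 * lam * t)) * sobolevEnergy i (cutExpr P p (v t))
        ≤ ENNReal.ofReal lam⁻¹ * ∫⁻ s in Ioo 0 t, ENNReal.ofReal (Real.exp (-2 * lam * s)) *
            sobolevEnergy i (slabResidual 1 T (fun s ↦ cutExpr P p (v s)) s) := hpt
      _ ≤ ENNReal.ofReal lam⁻¹ * ∑ q, ∫⁻ s in Ioo 0 t, ENNReal.ofReal (Real.exp (-2 * lam * s)) *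
            sobolevEnergy i (slabResidual 1 T (fun s ↦ cutExpr P q (v s)) s) :=
          mul_le_mul' le_rfl (Finset.single_le_sum (f := fun q ↦ ∫⁻ s in Ioo 0 t, ENNReal.ofReal (Real.exp (-2 * lam * s)) *
            sobolevEnergy i (slabResidual 1 T (fun s ↦ cutExpr P q (v s)) s)) (fun _ _ ↦ bot_le) (Finset.mem_univ p))
      _ ≤ ENNReal.ofReal lam⁻¹ * (C * G) := mul_le_mul' le_rfl hap
      _ ≤ ((Module.finrank ℝ E' : ℝ≥0∞) + 2) * C * ENNReal.ofReal lam⁻¹ * G := by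
          rw [show ENNReal.ofReal lam⁻¹ * (C * G) = 1 * C * ENNReal.ofReal lam⁻¹ * G by ring]
          gcongr
          exact le_add_left (by norm_num)

end PatchSystemLoc

end Literature.Analysis.PDE
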